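import Literature.Probability.Percolation.KhSThreeDisorderBoundaryValues
import HarnessLib

/-!
# The SITE LAW of the link-pattern law, loop side, any number of marks: the two mid-edges around one boundary hexagon agree

Topic `Literature/Probability/Percolation`; generic-`k` layer of the three-disorder lineage (companion of `MarkedLoopLinkPatternLaw.lean`).
Two edges `b ≠ b'` of `H_G` with a common face `F` of `𝕋` whose third side is NOT an edge of `H_G` (a «tip» of `H_G`: one site of
`F` in `G` — the configuration of two consecutive boundary darts with the same tail around a non-marked boundary hexagon), `F` not a
corner face, `b` read at the face `v` across `b` from `F` and `b'` at `v'` across `b'`. For the XOR spaces of Khristoforov–Smirnov's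
link pattern (`TXb`, corner faces and one more face odd) TOGGLING THE HALF-EDGE `b'` is a bijection

  `W(corners Δ {F}) at b ≅ W(corners Δ {v'}) at b'`   (`erase_mem_TXb`, `insert_mem_TXb_iff`),

because in the first space `F` is odd with `b` forbidden, so its only available side `b'` is PRESENT (`side'_mem_of_mem_TXb`), and in the
second `F` is even with `b'` forbidden, so `b` is ABSENT (`side_not_mem_of_mem_TXb'`). The toggle moves the start of the strand from `F`
across `b'` to `v'` and keeps its end (`reachable_erase`, `reachable_of_erase`: a walk from `F` must begin with `b'`, and a walk that
re-enters the valence-one face `F` leaves it again through `b'`). Hence, for every corner index `j`,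

★ `card_filter_inClassX_tip_eq` — `#{ξ ∈ W_b(F) : F ↔ u_j} = #{η ∈ W_{b'}(v') : v' ↔ u_j}`, and with the two roles of `b`, `b'` exchanged
★ `site_law_classCount` — `N_j(z) = N_j(z')`: the class counts of the link-pattern law (both halves of each subdivided edge, exactly the
summands of `MarkedLoops.classCountK`) AGREE at the two mid-edges `z ∈ b`, `z' ∈ b'`. This is the loop-side, every-`k` form of the
lane's boundary SITE LAW (T-SITE) (`k = 5`: `Bdry.boundarySiteLaw`; `k = 3`: `hobs_site_law₃`, both on the percolation side): the law of
the link pattern of a boundary mid-edge is a function of the boundary HEXAGON. ★ `exists_tipFace_of_apex_not_mem` discharges `TipFace`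
from the boundary geometry (a boundary dart `(u, v)` whose left face has its apex outside `G` and is not a corner face).

## References
* M. Khristoforov, S. Smirnov, *Percolation and O(1) loop model*, arXiv:2111.15612 (2021), §1.2 (arXiv v1 p. 2: loop representation
  with disorders on mid-edges, half-edges, the link pattern `IP(ξ)`), §2 Definition 3 (p. 4), Remark 6 (p. 5: «can also be defined on the vertices … the same functions»).
* B. Bollobás, O. Riordan, *Percolation*, CUP (2006), Ch. 7 §7.2.2 (pp. 191–195): discrete domains of `𝕋` and their boundary.

## Mathlib / tree
Mathlib: `SimpleGraph.Walk` (induction on length), `SimpleGraph.Reachable.mono`, `Finset.card_bij`. Tree: `KhSThreeDisorderObservable.lean`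
(`TXb`, `mem_TXb_iff`, `InClassX`, `hbK_inClassX_iff`), `MarkedLoopSpace.lean` (`eq_or_eq_of_inc_three`, `mem_touching_of_side_mem`, `corners`),
`FivePointNormalisation.lean` (`N5.sideGraph`, `side_oppFace_oppIdx`, `xiDeg_erase_side`, `xiDeg_erase_of_forall_ne`, `l1_xiDeg_eq`),
`TriDiscInterface.lean` (`oppFace_oppFace`), `TriDiscShelling.lean` (`exists_eq_faceVertex_of_adj`, `leftFace_faceVertex`, `triLeftApex_faceVertex`,
`hexFaceVertices_leftFace`, `leftFace_ne_leftFace_symm`), `TriDiscreteDomain.lean` (`triGraph_adj_triLeftApex_left`, `triLeftApex_ne`).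
-/

open Finset

namespace Literature.Probability.Percolation.MarkedLoops

open Literature.Probability.Percolation Literature.Probability.LatticeModels
open Literature.Probability.Percolation.FivePoint (side side_injective xiDeg XiLinked Inc inc_side inc_mk_iff)
open Literature.Probability.Percolation.FivePoint.N5 (sideGraph side_oppFace_oppIdx xiLinked_iff_reachable l1_xiDeg_eq xiDeg_erase_side
  xiDeg_erase_of_forall_ne)
open TriMarkedDomain

section TipFace

variable {nm : ℕ} {D : TriMarkedDomain nm}

/-- **A TIP between two edges of `H_G`.** The faces `v`, `v'` read the bonds `b = side v i`, `b' = side v' i'` of `H_G` and see the SAME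
face `F` across them; `b ≠ b'`; every `H_G`-side of `F` is `b` or `b'`; `F` is not a corner face. (Two consecutive boundary darts with a
common tail around a non-marked boundary hexagon.) [cite: BollobasRiordan2006, Ch. 7 §7.2.2 pp. 191–195] -/
structure TipFace (D : TriMarkedDomain nm) (v : HexVertex) (i : Fin 3) (v' : HexVertex) (i' : Fin 3) : Prop where
  /-- the two bonds are read across the same face `F` -/
  opp_eq : oppFace v i = oppFace v' i'
  /-- the two bonds differ -/
  side_ne : side v i ≠ side v' i'
  /-- `b` is an edge of `H_G` -/
  side_mem : side v i ∈ hBonds D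
  /-- `b'` is an edge of `H_G` -/
  side'_mem : side v' i' ∈ hBonds D
  /-- every `H_G`-side of `F` is one of the two bonds -/
  sides : ∀ j : Fin 3, side (oppFace v i) j ∈ hBonds D → side (oppFace v i) j = side v i ∨ side (oppFace v i) j = side v' i'
  /-- `F` is not a corner face -/
  not_corner : oppFace v i ∉ corners D

/-- the tip structure is symmetric in the two bonds. [cite: BollobasRiordan2006, Ch. 7 §7.2.2 pp. 191–195] -/
theorem TipFace.symm {v v' : HexVertex} {i i' : Fin 3} (T : TipFace D v i v' i') : TipFace D v' i' v i where
  opp_eq := T.opp_eq.symm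
  side_ne := T.side_ne.symm
  side_mem := T.side'_mem
  side'_mem := T.side_mem
  sides j hj := by
    rw [← T.opp_eq] at hj ⊢
    exact (T.sides j hj).symm
  not_corner := by rw [← T.opp_eq]; exact T.not_corner

variable {v v' : HexVertex} {i i' : Fin 3} (T : TipFace D v i v' i')
include T

/-- `b'` as a side of `F`. [folklore] -/
private theorem TipFace.side_oppIdx' : side (oppFace v i) (oppIdx v' i') = side v' i' := by
  rw [T.opp_eq]; exact side_oppFace_oppIdx v' i'

/-- across `b'` from `F` lies `v'`. [folklore] -/
private theorem TipFace.oppFace_oppIdx' : oppFace (oppFace v i) (oppIdx v' i') = v' := by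
  rw [T.opp_eq]; exact oppFace_oppFace v' i'

/-- `F` touches `G`. [folklore] -/
private theorem TipFace.touching : oppFace v i ∈ triFacesTouching D.verts :=
  mem_touching_of_side_mem D (j := oppIdx v' i') (by rw [T.side_oppIdx']; exact T.side'_mem)

/-- `v' ≠ F`. [folklore] -/
private theorem TipFace.ne' : v' ≠ oppFace v i := fun e => (hexGraph_adj_oppFace v' i').ne (e.trans T.opp_eq)

/-- a corner face is not the tip. [folklore] -/
private theorem TipFace.yc_ne (j : Fin nm) : yc D j ≠ oppFace v i := fun e => T.not_corner (e ▸ yc_mem_corners D j)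

/-- **the faces of `b'`**: a face with `b'` among its sides is `v'` or `F`. [cite: KhristoforovSmirnov2021, §1.2 (arXiv v1 p. 2)] -/
theorem TipFace.eq_or_eq_of_side_eq {G : HexVertex} {j : Fin 3} (h : side G j = side v' i') : G = v' ∨ G = oppFace v i := by
  have hG : G ∈ triFacesTouching D.verts := mem_touching_of_side_mem D (j := j) (by rw [h]; exact T.side'_mem)
  have hv' : v' ∈ triFacesTouching D.verts := mem_touching_of_side_mem D (j := i') T.side'_mem
  exact eq_or_eq_of_inc_three D T.side'_mem hv' T.touching hG (inc_side v' i') (by rw [← T.side_oppIdx']; exact inc_side _ _)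
    (by rw [← h]; exact inc_side G j) T.ne'

/-- an `H_G`-side of `F` lying in a set that avoids `b` is `b'`. [cite: KhristoforovSmirnov2021, §1.2 (arXiv v1 p. 2)] -/
theorem TipFace.side_eq_of_mem {ξ : Finset (Sym2 (Site 2))} (hξ : ξ ⊆ (hBonds D).erase (side v i)) {j : Fin 3}
    (hj : side (oppFace v i) j ∈ ξ) : j = oppIdx v' i' := by
  have hm := Finset.mem_erase.1 (hξ hj)
  rcases T.sides j hm.2 with e | e
  · exact absurd e hm.1
  · exact side_injective _ (e.trans T.side_oppIdx'.symm)

/-- **the side count of the tip** in a set avoiding `b`: `1` or `0` according as `b' ∈ ξ`. [cite: KhristoforovSmirnov2021, §1.2 (arXiv v1 p. 2)] -/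
theorem TipFace.xiDeg_eq {ξ : Finset (Sym2 (Site 2))} (hξ : ξ ⊆ (hBonds D).erase (side v i)) :
    xiDeg ξ (oppFace v i) = if side v' i' ∈ ξ then 1 else 0 := by
  classical
  rw [l1_xiDeg_eq]
  have key : ∀ j : Fin 3, side (oppFace v i) j ∈ ξ ↔ j = oppIdx v' i' ∧ side v' i' ∈ ξ := by
    intro j
    constructor
    · intro hj
      have e := T.side_eq_of_mem hξ hj
      refine ⟨e, ?_⟩
      rw [e, T.side_oppIdx'] at hj
      exact hj
    · rintro ⟨rfl, h⟩
      rw [T.side_oppIdx']; exact h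
  split_ifs with h
  · rw [Finset.card_eq_one]
    refine ⟨oppIdx v' i', ?_⟩
    ext j
    simp only [Finset.mem_filter, Finset.mem_univ, true_and, Finset.mem_singleton, key]
    exact ⟨fun hj => hj.1, fun hj => ⟨hj, h⟩⟩
  · rw [Finset.card_eq_zero, Finset.filter_eq_empty_iff]
    intro j _ hj
    exact h ((key j).1 hj).2

/-- ★ **in `W_b(F)` the half-edge `b'` is PRESENT** (`F` is odd and its only available side is `b'`). [cite: KhristoforovSmirnov2021, §1.2 (arXiv v1 p. 2)] -/
theorem side'_mem_of_mem_TXb {ξ : Finset (Sym2 (Site 2))} (hξ : ξ ∈ TXb D v i (oppFace v i)) : side v' i' ∈ ξ := by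
  classical
  obtain ⟨hsub, hpar⟩ := (mem_TXb_iff (D := D) v i (oppFace v i) ξ).1 hξ
  have hodd : Odd (xiDeg ξ (oppFace v i)) := by
    rw [hpar _ T.touching, Finset.mem_symmDiff, Finset.mem_singleton]
    exact Or.inr ⟨rfl, T.not_corner⟩
  rw [T.xiDeg_eq hsub] at hodd
  by_contra h
  rw [if_neg h] at hodd
  exact (by decide : ¬ Odd 0) hodd

/-- ★ **in `W_{b'}(v')` the half-edge `b` is ABSENT** (`F` is even there and `b'` is forbidden). [cite: KhristoforovSmirnov2021, §1.2 (arXiv v1 p. 2)] -/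
theorem side_not_mem_of_mem_TXb' {η : Finset (Sym2 (Site 2))} (hη : η ∈ TXb D v' i' v') : side v i ∉ η := by
  classical
  obtain ⟨hsub, hpar⟩ := (mem_TXb_iff (D := D) v' i' v' η).1 hη
  have heven : ¬ Odd (xiDeg η (oppFace v' i')) := by
    rw [hpar _ (T.opp_eq ▸ T.touching), Finset.mem_symmDiff, Finset.mem_singleton]
    rintro (⟨hc, -⟩ | ⟨e, -⟩)
    · exact T.not_corner (T.opp_eq ▸ hc)
    · exact T.ne' (e.symm.trans T.opp_eq.symm)
  rw [T.symm.xiDeg_eq hsub] at heven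
  intro h
  rw [if_pos h] at heven
  exact heven odd_one

/-- ★ **TOGGLING `b'` — the parity bookkeeping**: for a set `ζ` containing neither bond, `ζ ∪ {b'} ∈ W_b(F) ↔ ζ ∈ W_{b'}(v')` (the side
counts change by one exactly at the two faces `F`, `v'` of `b'`). [cite: KhristoforovSmirnov2021, §1.2 (arXiv v1 p. 2)] -/
theorem insert_mem_TXb_iff {ζ : Finset (Sym2 (Site 2))} (hb' : side v' i' ∉ ζ) (hb : side v i ∉ ζ) :
    insert (side v' i') ζ ∈ TXb D v i (oppFace v i) ↔ ζ ∈ TXb D v' i' v' := by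
  classical
  rw [mem_TXb_iff, mem_TXb_iff]
  -- side counts after the toggle
  have hdegv : xiDeg (insert (side v' i') ζ) v' = xiDeg ζ v' + 1 := by
    have h := xiDeg_erase_side (ξ := insert (side v' i') ζ) (F := v') (j₀ := i') (Finset.mem_insert_self _ _)
    rw [Finset.erase_insert hb'] at h
    exact h.symm
  have hdegF : xiDeg (insert (side v' i') ζ) (oppFace v i) = xiDeg ζ (oppFace v i) + 1 := by
    have h := xiDeg_erase_side (ξ := insert (side v' i') ζ) (F := oppFace v i) (j₀ := oppIdx v' i')
      (by rw [T.side_oppIdx']; exact Finset.mem_insert_self _ _)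
    rw [T.side_oppIdx', Finset.erase_insert hb'] at h
    exact h.symm
  have hdeg : ∀ G, G ≠ v' → G ≠ oppFace v i → xiDeg (insert (side v' i') ζ) G = xiDeg ζ G := by
    intro G h1 h2
    have hne : ∀ j : Fin 3, side G j ≠ side v' i' := fun j e => by
      rcases T.eq_or_eq_of_side_eq e with h | h
      · exact h1 h
      · exact h2 h
    have h := xiDeg_erase_of_forall_ne (ξ := insert (side v' i') ζ) (F := G) hne
    rw [Finset.erase_insert hb'] at h
    exact h.symm
  -- the two parity profiles at the special faces
  have hA : oppFace v i ∈ symmDiff (corners D) {oppFace v i} := by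
    rw [Finset.mem_symmDiff, Finset.mem_singleton]
    exact Or.inr ⟨rfl, T.not_corner⟩
  have hB : oppFace v i ∉ symmDiff (corners D) {v'} := by
    rw [Finset.mem_symmDiff, Finset.mem_singleton]
    rintro (⟨hc, -⟩ | ⟨e, -⟩)
    · exact T.not_corner hc
    · exact T.ne' e.symm
  have hC : v' ∈ symmDiff (corners D) {oppFace v i} ↔ v' ∈ corners D := by
    rw [Finset.mem_symmDiff, Finset.mem_singleton]
    constructor
    · rintro (⟨hc, -⟩ | ⟨e, -⟩)
      · exact hc
      · exact absurd e T.ne'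
    · intro hc
      exact Or.inl ⟨hc, T.ne'⟩
  have hD' : v' ∈ symmDiff (corners D) {v'} ↔ v' ∉ corners D := by
    rw [Finset.mem_symmDiff, Finset.mem_singleton]
    constructor
    · rintro (⟨-, hn⟩ | ⟨-, hc⟩)
      · exact absurd rfl hn
      · exact hc
    · intro hc
      exact Or.inr ⟨rfl, hc⟩
  have hE : ∀ G, G ≠ v' → G ≠ oppFace v i → (G ∈ symmDiff (corners D) {oppFace v i} ↔ G ∈ symmDiff (corners D) {v'}) := by
    intro G h1 h2
    rw [Finset.mem_symmDiff, Finset.mem_symmDiff, Finset.mem_singleton, Finset.mem_singleton]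
    constructor
    · rintro (⟨hc, -⟩ | ⟨e, -⟩)
      · exact Or.inl ⟨hc, h1⟩
      · exact absurd e h2
    · rintro (⟨hc, -⟩ | ⟨e, -⟩)
      · exact Or.inl ⟨hc, h2⟩
      · exact absurd e h1
  have key : ∀ G ∈ triFacesTouching D.verts,
      ((Odd (xiDeg (insert (side v' i') ζ) G) ↔ G ∈ symmDiff (corners D) {oppFace v i}) ↔
        (Odd (xiDeg ζ G) ↔ G ∈ symmDiff (corners D) {v'})) := by
    intro G _
    by_cases h2 : G = oppFace v i
    · rw [h2, hdegF, Nat.odd_add_one, iff_true_intro hA, iff_false_intro hB, iff_true, iff_false]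
    · by_cases h1 : G = v'
      · rw [h1, hdegv, Nat.odd_add_one, hC, hD']
        tauto
      · rw [hdeg G h1 h2, hE G h1 h2]
  have hb'B : side v' i' ∈ (hBonds D).erase (side v i) := Finset.mem_erase.2 ⟨T.side_ne.symm, T.side'_mem⟩
  constructor
  · rintro ⟨hsub, hpar⟩
    refine ⟨fun e he => Finset.mem_erase.2 ⟨fun h => hb' (h ▸ he), (Finset.mem_erase.1 (hsub (Finset.mem_insert_of_mem he))).2⟩,
      fun G hG => ?_⟩
    exact (key G hG).1 (hpar G hG)
  · rintro ⟨hsub, hpar⟩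
    refine ⟨?_, fun G hG => (key G hG).2 (hpar G hG)⟩
    intro e he
    rcases Finset.mem_insert.1 he with rfl | he
    · exact hb'B
    · exact Finset.mem_erase.2 ⟨fun h => hb (h ▸ he), (Finset.mem_erase.1 (hsub he)).2⟩

/-- ★ **the toggle maps `W_b(F)` into `W_{b'}(v')`.** [cite: KhristoforovSmirnov2021, §1.2 (arXiv v1 p. 2)] -/
theorem erase_mem_TXb {ξ : Finset (Sym2 (Site 2))} (hξ : ξ ∈ TXb D v i (oppFace v i)) : ξ.erase (side v' i') ∈ TXb D v' i' v' := by
  classical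
  have hb' := side'_mem_of_mem_TXb T hξ
  have hsub := ((mem_TXb_iff (D := D) v i (oppFace v i) ξ).1 hξ).1
  have hb : side v i ∉ ξ.erase (side v' i') := fun h => (Finset.mem_erase.1 (hsub (Finset.mem_of_mem_erase h))).1 rfl
  rw [← Finset.insert_erase hb'] at hξ
  exact (insert_mem_TXb_iff T (Finset.notMem_erase _ _) hb).1 hξ

omit T in
/-- the side graph is monotone in the edge set. [folklore] -/
private theorem sideGraph_erase_le (ξ : Finset (Sym2 (Site 2))) (e : Sym2 (Site 2)) : sideGraph (ξ.erase e) ≤ sideGraph ξ :=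
  fun _ _ ⟨j, h1, h2⟩ => ⟨j, h1, Finset.mem_of_mem_erase h2⟩

/-- **walks that avoid the tip survive the toggle**: in a set `ξ` avoiding `b`, a walk of the side graph between two faces other than `F`
gives a walk of the side graph of `ξ ∖ {b'}` (a visit to the valence-one face `F` is an excursion `v' → F → v'`, which is cut out).
[cite: KhristoforovSmirnov2021, §1.2 (arXiv v1 p. 2: `IP(ξ)` is a union of disjoint paths)] -/
theorem reachable_erase_of_walk {ξ : Finset (Sym2 (Site 2))} (hξ : ξ ⊆ (hBonds D).erase (side v i)) {Y : HexVertex}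
    (hY : Y ≠ oppFace v i) (n : ℕ) :
    ∀ {x : HexVertex} (p : (sideGraph ξ).Walk x Y), p.length ≤ n → x ≠ oppFace v i →
      (sideGraph (ξ.erase (side v' i'))).Reachable x Y := by
  induction n with
  | zero =>
    intro x p hp hx
    cases p with
    | nil => exact SimpleGraph.Reachable.refl _
    | cons h q => simp at hp
  | succ n ih =>
    intro x p hp hx
    cases p with
    | nil => exact SimpleGraph.Reachable.refl _
    | cons h q =>
      rename_i x₁
      rw [SimpleGraph.Walk.length_cons] at hp
      obtain ⟨j, hx₁, hj⟩ := h
      by_cases hb : side x j = side v' i'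
      · -- the step crosses `b'`: `x = v'`, `x₁ = F`, and the walk must come straight back
        have hx' : x = v' := (T.eq_or_eq_of_side_eq hb).resolve_right hx
        have hjj : j = i' := side_injective v' (by rw [hx'] at hb; exact hb)
        have hx₁' : x₁ = oppFace v i := by rw [hx₁, hx', hjj, ← T.opp_eq]
        subst hx₁'
        cases q with
        | nil => exact absurd rfl hY
        | cons h' q' =>
          rename_i x₂
          rw [SimpleGraph.Walk.length_cons] at hp
          obtain ⟨j', hx₂, hj'⟩ := h'
          have hjj' : j' = oppIdx v' i' := T.side_eq_of_mem hξ hj'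
          have hx₂' : x₂ = v' := by rw [hx₂, hjj', T.oppFace_oppIdx']
          rw [hx']
          exact hx₂' ▸ ih q' (by omega) (by rw [hx₂']; exact T.ne')
      · -- the step survives
        have hadj : (sideGraph (ξ.erase (side v' i'))).Adj x x₁ := ⟨j, hx₁, Finset.mem_erase.2 ⟨hb, hj⟩⟩
        have hx₁F : x₁ ≠ oppFace v i := by
          intro e
          have hs : side (oppFace v i) (oppIdx x j) = side x j := by rw [← e, hx₁, side_oppFace_oppIdx]
          have hjj := T.side_eq_of_mem hξ (j := oppIdx x j) (by rw [hs]; exact hj)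
          rw [hjj, T.side_oppIdx'] at hs
          exact hb hs.symm
        exact hadj.reachable.trans (ih q (by omega) hx₁F)

/-- ★ **the strand of `z` after the toggle**: if `F` is linked to `Y ≠ F` in `ξ ∈ W_b(F)`, then `v'` is linked to `Y` in `ξ ∖ {b'}`.
[cite: KhristoforovSmirnov2021, §1.2 (arXiv v1 p. 2: `IP(ξ)` is a union of disjoint paths)] -/
theorem reachable_erase {ξ : Finset (Sym2 (Site 2))} (hξ : ξ ∈ TXb D v i (oppFace v i)) {Y : HexVertex} (hY : Y ≠ oppFace v i)
    (h : (sideGraph ξ).Reachable (oppFace v i) Y) : (sideGraph (ξ.erase (side v' i'))).Reachable v' Y := by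
  have hsub := ((mem_TXb_iff (D := D) v i (oppFace v i) ξ).1 hξ).1
  obtain ⟨p⟩ := h
  cases p with
  | nil => exact absurd rfl hY
  | cons h' q =>
    rename_i x₁
    obtain ⟨j, hx₁, hj⟩ := h'
    have hjj : j = oppIdx v' i' := T.side_eq_of_mem hsub hj
    have hx₁' : x₁ = v' := by rw [hx₁, hjj, T.oppFace_oppIdx']
    exact hx₁' ▸ reachable_erase_of_walk T hsub hY q.length q le_rfl (by rw [hx₁']; exact T.ne')

/-- ★ **and back**: if `v'` is linked to `Y` avoiding `b'`, then `F` is linked to `Y` once `b'` is present.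
[cite: KhristoforovSmirnov2021, §1.2 (arXiv v1 p. 2: `IP(ξ)` is a union of disjoint paths)] -/
theorem reachable_of_erase {ξ : Finset (Sym2 (Site 2))} (hb' : side v' i' ∈ ξ) {Y : HexVertex}
    (h : (sideGraph (ξ.erase (side v' i'))).Reachable v' Y) : (sideGraph ξ).Reachable (oppFace v i) Y := by
  have hadj : (sideGraph ξ).Adj (oppFace v i) v' := ⟨oppIdx v' i', T.oppFace_oppIdx'.symm, by rw [T.side_oppIdx']; exact hb'⟩
  exact hadj.reachable.trans (h.mono (sideGraph_erase_le ξ _))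

open Classical in
/-- ★★ **THE TOGGLE IS A CLASS-PRESERVING BIJECTION `W_b(F) ≅ W_{b'}(v')`**: for every corner index `j`, the configurations at `b` with
odd face `F` linked to `u_j` are equinumerous with the configurations at `b'` with odd face `v'` linked to `u_j`.
[cite: KhristoforovSmirnov2021, §1.2 (arXiv v1 p. 2) and §2 Definition 3 (p. 4)] -/
theorem card_filter_inClassX_tip_eq (j : Fin nm) :
    #((TXb D v i (oppFace v i)).filter fun ξ => InClassX D (faceVertex v (i + 1)) (faceVertex v (i + 2)) (oppFace v i) j ξ) =
      #((TXb D v' i' v').filter fun η => InClassX D (faceVertex v' (i' + 1)) (faceVertex v' (i' + 2)) v' j η) := by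
  classical
  refine Finset.card_bij (fun ξ _ => ξ.erase (side v' i')) (fun ξ hξ => ?_) (fun ξ₁ h₁ ξ₂ h₂ h => ?_) (fun η hη => ?_)
  · rw [Finset.mem_filter] at hξ ⊢
    obtain ⟨hmem, hcl⟩ := hξ
    rw [hbK_inClassX_iff] at hcl ⊢
    exact ⟨erase_mem_TXb T hmem, erase_mem_TXb T hmem, reachable_erase T hmem (T.yc_ne j) hcl.2⟩
  · have hb1 := side'_mem_of_mem_TXb T (Finset.mem_filter.1 h₁).1
    have hb2 := side'_mem_of_mem_TXb T (Finset.mem_filter.1 h₂).1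
    rw [← Finset.insert_erase hb1, ← Finset.insert_erase hb2, h]
  · rw [Finset.mem_filter] at hη
    obtain ⟨hmem, hcl⟩ := hη
    have hb : side v i ∉ η := side_not_mem_of_mem_TXb' T hmem
    have hb' : side v' i' ∉ η := fun h => (Finset.mem_erase.1 (((mem_TXb_iff (D := D) v' i' v' η).1 hmem).1 h)).1 rfl
    have hmem' : insert (side v' i') η ∈ TXb D v i (oppFace v i) := (insert_mem_TXb_iff T hb' hb).2 hmem
    refine ⟨insert (side v' i') η, ?_, Finset.erase_insert hb'⟩
    rw [Finset.mem_filter, hbK_inClassX_iff]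
    rw [hbK_inClassX_iff] at hcl
    refine ⟨hmem', hmem', ?_⟩
    exact reachable_of_erase T (Finset.mem_insert_self _ _) (by rw [Finset.erase_insert hb']; exact hcl.2)

open Classical in
/-- ★★★ **THE SITE LAW (loop side, every number of marks).** For the two `H_G`-edges `b = side v i`, `b' = side v' i'` around a tip
(`TipFace`): the number `N_j` of loop configurations with disorders at the corners and at the mid-edge — both halves of the subdivided
edge, i.e. `#{W_b(v) : v ↔ u_j} + #{W_b(F) : F ↔ u_j}` — is the SAME at `b` and at `b'`, for every corner `u_j`. (These sums are
`MarkedLoops.classCountK D v i j` and `classCountK D v' i' j` of `MarkedLoopLinkPatternLaw.lean`, by `rfl`.)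
[cite: KhristoforovSmirnov2021, §1.2 (the law of the link pattern; arXiv v1 p. 2), §2 Definition 3 (p. 4) and Remark 6 (p. 5, asserted at k = 3)] -/
theorem site_law_classCount (j : Fin nm) :
    #((TXb D v i v).filter fun ξ => InClassX D (faceVertex v (i + 1)) (faceVertex v (i + 2)) v j ξ) +
        #((TXb D v i (oppFace v i)).filter fun ξ => InClassX D (faceVertex v (i + 1)) (faceVertex v (i + 2)) (oppFace v i) j ξ) =
      #((TXb D v' i' v').filter fun ξ => InClassX D (faceVertex v' (i' + 1)) (faceVertex v' (i' + 2)) v' j ξ) +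
        #((TXb D v' i' (oppFace v' i')).filter fun ξ =>
          InClassX D (faceVertex v' (i' + 1)) (faceVertex v' (i' + 2)) (oppFace v' i') j ξ) := by
  rw [card_filter_inClassX_tip_eq T j, add_comm]
  congr 1
  exact (card_filter_inClassX_tip_eq T.symm j).symm

end TipFace

section Geometry

/-! ## The tip of a turning boundary hexagon

`TipFace` discharged from the boundary geometry: a boundary dart `(u, v)` of `G` (`u ∈ G`, `v ∉ G`) whose successor in the boundary
walk keeps the tail `u` — equivalently, the apex `w` of the face `F` left of `u → v` is outside `G` — gives the tip `F = (u, v, w)`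
between the `H_G`-edges `b = uv` (read at the face `x` right of `u → v`) and `b' = uw` (read at the face `x'` left of `u → w`). -/

variable {nm : ℕ} {D : TriMarkedDomain nm}

/-- Auxiliary. [folklore] -/
private theorem fin3_cases_tip (k j : Fin 3) : j = k ∨ j = k + 1 ∨ j = k + 2 := by
  revert k j; decide

/-- Auxiliary. [folklore] -/
private theorem fin3_arith_tip (k : Fin 3) : k + 1 + 1 = k + 2 ∧ k + 1 + 2 = k ∧ k + 2 + 1 = k ∧ k + 2 + 2 = k + 1 := by
  revert k; decide

/-- the face left of `w → u`, `w` the apex of the face left of `u → v`, is that face. [folklore] -/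
private theorem leftFace_apex_left {u v : Site 2} (h : triGraph.Adj u v) : leftFace (triLeftApex u v) u = leftFace u v := by
  obtain ⟨k, hu, hv⟩ := exists_eq_faceVertex_of_adj h
  set F := leftFace u v
  rw [hu, hv, triLeftApex_faceVertex]
  have := leftFace_faceVertex F (k + 2)
  rwa [(fin3_arith_tip k).2.2.1] at this

/-- **the face across a side**: if `side x j = uv` (`u ∈ G`) and `G'` is a touching face incident to `uv` other than `x`, then
`oppFace x j = G'`. [cite: KhristoforovSmirnov2021, §1.2 (arXiv v1 p. 2)] -/
private theorem oppFace_eq_of_inc {x G' : HexVertex} {j : Fin 3} {u v : Site 2} (hu : u ∈ D.verts) (hadj : triGraph.Adj u v)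
    (hx : side x j = s(u, v)) (hG' : G' ∈ triFacesTouching D.verts) (hinc : Inc G' s(u, v)) (hne : G' ≠ x) : oppFace x j = G' := by
  have hb : s(u, v) ∈ hBonds D := mem_hBonds D hadj (Or.inl hu)
  have hxt : x ∈ triFacesTouching D.verts := mem_touching_of_side_mem D (j := j) (by rw [hx]; exact hb)
  have hot : oppFace x j ∈ triFacesTouching D.verts :=
    mem_touching_of_side_mem D (j := oppIdx x j) (by rw [side_oppFace_oppIdx, hx]; exact hb)
  have ix : Inc x s(u, v) := by rw [← hx]; exact inc_side x j
  have io : Inc (oppFace x j) s(u, v) := by rw [← hx, ← side_oppFace_oppIdx x j]; exact inc_side _ _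
  rcases eq_or_eq_of_inc_three D hb hxt hot hG' ix io hinc (hexGraph_adj_oppFace x j).ne with e | e
  · exact absurd e hne
  · exact e.symm

/-- ★ **THE TIP OF A TURNING BOUNDARY HEXAGON**: for a boundary dart `(u, v)` of `G` whose face `F = leftFace u v` has its apex
`w = triLeftApex u v` outside `G`, and `F` not a corner face, the face `x = leftFace v u` with the side index of `uv` and the face
`x' = leftFace u w` with the side index of `uw` form a `TipFace` (so `site_law_classCount` applies to the two consecutive boundary darts
`(u, v)`, `(u, w) = triBdrySucc G (u, v)`). [cite: BollobasRiordan2006, Ch. 7 §7.2.2 pp. 191–195] -/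
theorem exists_tipFace_of_apex_not_mem {u v : Site 2} (hu : u ∈ D.verts) (hv : v ∉ D.verts) (hadj : triGraph.Adj u v)
    (hw : triLeftApex u v ∉ D.verts) (hF : leftFace u v ∉ corners D) :
    ∃ i i' : Fin 3, side (leftFace v u) i = s(u, v) ∧ side (leftFace u (triLeftApex u v)) i' = s(u, triLeftApex u v) ∧
      oppFace (leftFace v u) i = leftFace u v ∧ TipFace D (leftFace v u) i (leftFace u (triLeftApex u v)) i' := by
  classical
  have hadj' : triGraph.Adj u (triLeftApex u v) := triGraph_adj_triLeftApex_left hadj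
  have hvw : v ≠ triLeftApex u v := fun e => (triLeftApex_ne hadj).2 e.symm
  have hb : s(u, v) ∈ hBonds D := mem_hBonds D hadj (Or.inl hu)
  have hb' : s(u, triLeftApex u v) ∈ hBonds D := mem_hBonds D hadj' (Or.inl hu)
  -- the vertices of F = leftFace u v: u, v, w at the indices k, k + 1, k + 2
  obtain ⟨k, huk, hvk⟩ := exists_eq_faceVertex_of_adj hadj
  have hwk : triLeftApex u v = faceVertex (leftFace u v) (k + 2) := by
    have := triLeftApex_faceVertex (leftFace u v) k
    rwa [← huk, ← hvk] at this
  have huF : u ∈ hexFaceVertices (leftFace u v) := by rw [hexFaceVertices_leftFace hadj]; simp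
  have hFt : leftFace u v ∈ triFacesTouching D.verts := mem_triFacesTouching.2 ⟨u, hu, huF⟩
  have hvF : v ∈ hexFaceVertices (leftFace u v) := by rw [hexFaceVertices_leftFace hadj]; simp
  have hwF : triLeftApex u v ∈ hexFaceVertices (leftFace u v) := by rw [hexFaceVertices_leftFace hadj]; simp
  have hFuv : Inc (leftFace u v) s(u, v) := inc_mk_iff.2 ⟨huF, hvF⟩
  have hFuw : Inc (leftFace u v) s(u, triLeftApex u v) := inc_mk_iff.2 ⟨huF, hwF⟩
  -- the side indices of b at x and of b' at x'
  have hxv : Inc (leftFace v u) s(u, v) := by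
    rw [inc_mk_iff, hexFaceVertices_leftFace hadj.symm]
    exact ⟨by simp, by simp⟩
  have hx'w : Inc (leftFace u (triLeftApex u v)) s(u, triLeftApex u v) := by
    rw [inc_mk_iff, hexFaceVertices_leftFace hadj']
    exact ⟨by simp, by simp⟩
  obtain ⟨i, hi⟩ := exists_side_eq_of_inc D hb hxv
  obtain ⟨i', hi'⟩ := exists_side_eq_of_inc D hb' hx'w
  have hFx : leftFace u v ≠ leftFace v u := leftFace_ne_leftFace_symm hadj
  have hFx' : leftFace u v ≠ leftFace u (triLeftApex u v) := by
    rw [← leftFace_apex_left hadj]; exact (leftFace_ne_leftFace_symm hadj').symm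
  have hopp : oppFace (leftFace v u) i = leftFace u v := oppFace_eq_of_inc hu hadj hi.symm hFt hFuv hFx
  have hopp' : oppFace (leftFace u (triLeftApex u v)) i' = leftFace u v := oppFace_eq_of_inc hu hadj' hi'.symm hFt hFuw hFx'
  refine ⟨i, i', hi.symm, hi'.symm, hopp, ?_⟩
  exact
    { opp_eq := hopp.trans hopp'.symm
      side_ne := by
        rw [← hi, ← hi']
        intro e
        rcases Sym2.eq_iff.1 e with ⟨-, h⟩ | ⟨h, -⟩
        · exact hvw h
        · exact hadj'.ne h
      side_mem := hi ▸ hb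
      side'_mem := hi' ▸ hb'
      sides := by
        intro j hj
        rw [hopp, ← hi, ← hi']
        rw [hopp] at hj
        have A := fin3_arith_tip k
        rcases fin3_cases_tip k j with rfl | rfl | rfl
        · -- the side `vw` of F is not an edge of `H_G`
          exfalso
          obtain ⟨a, c, he, ha, -⟩ := exists_rep_of_mem_hBonds D hj
          unfold side at he
          rw [← hvk, ← hwk] at he
          have ha' : a ∈ (s(v, triLeftApex u v) : Sym2 (Site 2)) := by rw [he]; exact Sym2.mem_mk_left a c
          rcases Sym2.mem_iff.1 ha' with rfl | rfl
          · exact hv ha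
          · exact hw ha
        · right
          unfold side
          rw [A.1, A.2.1, ← hwk, ← huk, Sym2.eq_swap]
        · left
          unfold side
          rw [A.2.2.1, A.2.2.2, ← huk, ← hvk]
      not_corner := by rw [hopp]; exact hF }

end Geometry

end Literature.Probability.Percolation.MarkedLoops
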